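import Summits.QuantumFields.YangMills.Theorems.UnitScaleTiltProp7TrueLinCentralRegPr
import Summits.QuantumFields.YangMills.Theorems.UnitScaleTiltProp7QTwCentralSectorRegPr
import Summits.QuantumFields.YangMills.Theorems.UnitScaleTiltProp7EngOfTrueAvgBudget
import HarnessLib

/-!
# Route `UnitScaleTilt`, crux K1 child «MinimiserStabilityRegPr» (stmt-QuantumFields-19200), stub `stub_existenceMinimalOrbit` (EX), lane II (B4★)∕(QB) «⊕ central» summand —
# **THE CENTRAL SECTOR OF (QB) IS BACKGROUND-FREE: ON `ℂ·1`-VALUED FIELDS THE ROW «TRUE AVERAGE ≤ TWISTED AVERAGE + LEGS» AT `W ∈ 𝔘_k(ε₀)` IS THE SAME ROW AT `W = 1`**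
# (the (QB-c)∕(QB-c′) identities of this seat, knitted in the letters of ✓`Prop7EngOfTrueAvgBudget.hEng_of_trueAvgBudget`'s `hQB` VERBATIM)

Cell `ym3-torus`, width seat `ym3-torus-px10` (gen 5; px19 g6 LOCATE v2 b7655206 §3 (c-i) «central-direction letters», px15 g5 hand-over 07:24Z).  `--supports stmt-QuantumFields-19200 --as helper`;
THEOREMS ONLY (0 `def`, 0 `sorry`); count-neutral; nothing here claims the stub, the crux, d = 4 or the mass gap — YM₃ on T³ is a ladder rung (R3), not the Clay problem.

THE MATHEMATICS.  (QB)'s five currencies on a central field `A = c·1` (`c : bonds → ℂ`) do not see the background: (i) the true-linearised family `Q (K−n) (c·1)` along `W̄^{(·)}` equals the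
same family along the flat tower (✓`Prop7TrueLinCentralRegPr.trueLinIter_smul_one_eq_flat_of_regPr` — `exp[mean log]` is homogeneous under central rescalings); (ii) the comb chart
`QTw W (c·1) = QTw 1 (c·1)` (✓`Prop7QTwCentralSectorRegPr.QTw_smul_one_eq_QTw_one_of_regPr` — central factors commute with every transport of the comb frames); (iii)–(iv) the covariant
curl and divergence of [Balaban1985BackgroundPropagators] (3.4)∕(3.8) act on `c·1` as the FLAT curl∕divergence of `c` times `1` at every background (`R(U)(c·1) = c·1`); (v) `Σ‖A(b)‖²`
has no background.  Hence the central (QB) row at `W` is the central (QB) row at `1` with the flat family — the abelian «true average ≤ twisted average + legs» row of the flat tower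
([Balaban1984PropagatorsI] (1.18)–(1.20)), which is (R-LEGS)-flat's business (px19 g6), not this file's.

WHAT IS PROVED (sorry-free, no definition):
* §1 (any ring `𝔸` with `Algebra ℂ 𝔸`, any shifts `T`, ANY background `U`; lit `B9Eq39Adjoint` letters): `covD_smul_one`, `covDstar_smul_one`, ★`curl_smul_one`, ★`divB_smul_one` (the flat
  scalar stencils times `1`), `curl_smul_one_eq`∕`divB_smul_one_eq` (two backgrounds give the same value).
* §2 ★★★`trueAvgBudget_smul_one_of_flat` — at `W ∈ RegPr F n K e` (`0 < e`, `10⁷L³e ≤ 1`), for the `hQs`-families `Q` (along `W̄^{(·)}`) and `Q₁` (along the flat tower) of `hQB`'s letters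
  VERBATIM, every `Cq Cq′ : ℝ` and every scalar field `c`: the (QB) inequality for `A := fun b ↦ c b • 1` at background `1` with `Q₁` IMPLIES the (QB) inequality for the same `A` at `W`
  with `Q` (both sides written β-reduced; `exact` matches (QB)'s instance `A := fun b ↦ c b • 1` definitionally).
HONEST SCOPE.  By-name knit of landed identities; the flat central row itself is NOT proved here; nothing of (QB)∕(ENG)∕(REC)∕`hN06`∕the crux is advanced by this file alone.

References: T. Bałaban, CMP **99** (1985) 389–434 [Balaban1985BackgroundPropagators] ((3.3)–(3.4) pp.390–391, (3.8) p.392, (3.14)–(3.15) p.393); CMP **95** (1984) 17–40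
[Balaban1984PropagatorsI] ((1.18)–(1.20) pp.19–20); CMP **102** (1985) 277–309 [Balaban1985Variational] ((2) p.278, (14) p.280, (44) p.285).
-/

set_option autoImplicit false

noncomputable section

open scoped BigOperators Matrix.Norms.L2Operator Matrix InnerProductSpace ComplexConjugate

namespace Summit.QuantumFields.YangMills.Theorems.Prop7TrueAvgBudgetCentral

open Literature.MathematicalPhysics.QuantumFieldTheory.Balaban1983to89
open Literature.MathematicalPhysics.QuantumFieldTheory.Balaban1983to89.T3ContinuumYM3Torus
open Literature.MathematicalPhysics.QuantumFieldTheory.Balaban1983to89.T3PrintedRegularMinimiser (RegPr)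
open T4Continuum BlockAveraging AveragingRT ExpMeanLog BlockAveragingEMLLinearised BlockAveragingEMLLinearisedBackground BlockAveragingEMLProp2
open B9Eq39Adjoint (R R_smul R_apply_one covD covDstar curl divB)
open B10Eq27TorusAxialLog (unitsField toUField)
open B9TorusCalculus (torusT)
open Summit.QuantumFields.YangMills.Theorems.Prop7SectET3HilbertLetters (W₂ frobEquiv)
open Summit.QuantumFields.YangMills.Theorems.Prop7SymAvgTw (QTw)
open Summit.QuantumFields.YangMills.Theorems.Prop7QTwCentralSectorRegPr (QTw_smul_one_eq_QTw_one_of_regPr)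
open Summit.QuantumFields.YangMills.Theorems.Prop7TrueLinCentralRegPr (trueLinIter_smul_one_eq_flat_of_regPr)

/-! ## §1 The covariant stencils of (3.3)∕(3.4)∕(3.8) on central fields are the flat ones, at every background -/

section Central

variable {𝔸 : Type*} [Ring 𝔸] [Algebra ℂ 𝔸] {S : Type*} {ι : Type*} (T : ι → Equiv.Perm S) (U : ι → S → 𝔸ˣ)

/-- `D_{U,μ}(q·1)(x) = (q(x+e_μ) − q(x))·1` at every background. [cite: Balaban1985BackgroundPropagators, (3.3) p.390] -/
theorem covD_smul_one (μ : ι) (q : S → ℂ) (x : S) :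
    covD T U μ (fun y => q y • (1 : 𝔸)) x = (q (T μ x) - q x) • (1 : 𝔸) := by
  rw [covD, R_smul, R_apply_one, sub_smul]

/-- `D*_{U,μ}(q·1)(x) = (q(x−e_μ) − q(x))·1` at every background. [cite: Balaban1985BackgroundPropagators, (3.8) p.392] -/
theorem covDstar_smul_one (μ : ι) (q : S → ℂ) (x : S) :
    covDstar T U μ (fun y => q y • (1 : 𝔸)) x = (q ((T μ).symm x) - q x) • (1 : 𝔸) := by
  rw [covDstar, R_smul, R_apply_one, sub_smul]

/-- ★ **THE COVARIANT CURL OF A CENTRAL ONE-FORM IS THE FLAT CURL OF ITS SCALAR**, at every background. [cite: Balaban1985BackgroundPropagators, (3.4) p.391] -/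
theorem curl_smul_one (d : ι → S → ℂ) (μ ν : ι) (x : S) :
    curl T U (fun κ y => d κ y • (1 : 𝔸)) μ ν x = ((d ν (T μ x) - d ν x) - (d μ (T ν x) - d μ x)) • (1 : 𝔸) := by
  rw [curl, sub_smul]
  exact congrArg₂ (· - ·) (covD_smul_one T U μ (d ν) x) (covD_smul_one T U ν (d μ) x)

/-- ★ **THE COVARIANT DIVERGENCE OF A CENTRAL ONE-FORM IS THE FLAT DIVERGENCE OF ITS SCALAR**, at every background. [cite: Balaban1985BackgroundPropagators, (3.8) p.392] -/
theorem divB_smul_one [Fintype ι] (d : ι → S → ℂ) (x : S) :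
    divB T U (fun κ y => d κ y • (1 : 𝔸)) x = (∑ μ, (d μ ((T μ).symm x) - d μ x)) • (1 : 𝔸) := by
  rw [divB, Finset.sum_smul]
  exact Finset.sum_congr rfl fun μ _ => covDstar_smul_one T U μ (d μ) x

/-- Two backgrounds give the same covariant curl of a central one-form. [cite: Balaban1985BackgroundPropagators, (3.4) p.391] -/
theorem curl_smul_one_eq (U U' : ι → S → 𝔸ˣ) (d : ι → S → ℂ) (μ ν : ι) (x : S) :
    curl T U (fun κ y => d κ y • (1 : 𝔸)) μ ν x = curl T U' (fun κ y => d κ y • (1 : 𝔸)) μ ν x := by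
  rw [curl_smul_one, curl_smul_one]

/-- Two backgrounds give the same covariant divergence of a central one-form. [cite: Balaban1985BackgroundPropagators, (3.8) p.392] -/
theorem divB_smul_one_eq [Fintype ι] (U U' : ι → S → 𝔸ˣ) (d : ι → S → ℂ) (x : S) :
    divB T U (fun κ y => d κ y • (1 : 𝔸)) x = divB T U' (fun κ y => d κ y • (1 : 𝔸)) x := by
  rw [divB_smul_one, divB_smul_one]

end Central

/-! ## §2 The central (QB) row at `W ∈ 𝔘_k(ε₀)` is the central (QB) row at `1` -/

section Member

variable (F : T3Family) {n K : ℕ}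

/-- ★★★ **(QB) ON THE CENTRE DOES NOT SEE THE BACKGROUND.**  At `W ∈ RegPr F n K e` (`0 < e`, `10⁷L³e ≤ 1`), for the `hQs`-family `Q` along `W̄^{(·)}` and the `hQs`-family `Q₁` along the
flat tower (the recursion of ✓`hEng_of_trueAvgBudget`'s `hQB` VERBATIM), all `Cq Cq′ : ℝ` and every scalar bond field `c`: the (QB) row for `A := fun b ↦ c b • 1` at background `1`
with `Q₁` implies the (QB) row for the same `A` at `W` with `Q` — by (i) ✓`trueLinIter_smul_one_eq_flat_of_regPr` (true averages), (ii) ✓`QTw_smul_one_eq_QTw_one_of_regPr` (comb chart),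
(iii)–(iv) `curl_smul_one_eq`∕`divB_smul_one_eq` (covariant curl∕divergence), (v) nothing to do.
[cite: Balaban1985BackgroundPropagators, (3.4) p.391, (3.8) p.392, (3.14)-(3.15) p.393; Balaban1984PropagatorsI, (1.18)-(1.20) pp.19-20; Balaban1985Variational, (14) p.280, (44) p.285] -/
theorem trueAvgBudget_smul_one_of_flat (hnK : n < K) {e : ℝ} (he : 0 < e) (hε : 10 ^ 7 * (F.L : ℝ) ^ 3 * e ≤ 1)
    (W : GaugeField (F.P K) 0 (Matrix.specialUnitaryGroup (Fin 2) ℂ)) (hreg : RegPr F n K e W)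
    (Q Q₁ : (k : ℕ) → (PBond (F.P K) 0 → Matrix (Fin 2) (Fin 2) ℂ) → PBond (F.P K) k → Matrix (Fin 2) (Fin 2) ℂ)
    (hQ0 : ∀ Y, Q 0 Y = Y)
    (hQs : ∀ (k : ℕ) (Y : PBond (F.P K) 0 → Matrix (Fin 2) (Fin 2) ℂ) (c : PBond (F.P K) (k + 1)), Q (k + 1) Y c
      = (fderiv ℂ (eml : (Idx (F.P K) → Matrix (Fin 2) (Fin 2) ℂ) → Matrix (Fin 2) (Fin 2) ℂ)
            (fun i => ((loopHol (Averaging.iter (fun i => blockAvg (P := (F.P K)) (j := i) (expMeanLogSU (n := Fin 2))) k W) c i : Matrix.specialUnitaryGroup (Fin 2) ℂ) : Matrix (Fin 2) (Fin 2) ℂ))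
            (fun i => covWalkSum (Averaging.iter (fun i => blockAvg (P := (F.P K)) (j := i) (expMeanLogSU (n := Fin 2))) k W) (Q k Y) (walk (emb c.src) (loopWord (F.P K).L c.dir (off i.1) i.2.1 i.2.2))
              * ((loopHol (Averaging.iter (fun i => blockAvg (P := (F.P K)) (j := i) (expMeanLogSU (n := Fin 2))) k W) c i : Matrix.specialUnitaryGroup (Fin 2) ℂ) : Matrix (Fin 2) (Fin 2) ℂ))
            * star ((corr (expMeanLogSU (n := Fin 2)) (Averaging.iter (fun i => blockAvg (P := (F.P K)) (j := i) (expMeanLogSU (n := Fin 2))) k W) c : Matrix.specialUnitaryGroup (Fin 2) ℂ) : Matrix (Fin 2) (Fin 2) ℂ)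
          + ((corr (expMeanLogSU (n := Fin 2)) (Averaging.iter (fun i => blockAvg (P := (F.P K)) (j := i) (expMeanLogSU (n := Fin 2))) k W) c : Matrix.specialUnitaryGroup (Fin 2) ℂ) : Matrix (Fin 2) (Fin 2) ℂ)
            * covWalkSum (Averaging.iter (fun i => blockAvg (P := (F.P K)) (j := i) (expMeanLogSU (n := Fin 2))) k W) (Q k Y) (walk (emb c.src) (List.replicate (F.P K).L (c.dir, true)))
            * star ((corr (expMeanLogSU (n := Fin 2)) (Averaging.iter (fun i => blockAvg (P := (F.P K)) (j := i) (expMeanLogSU (n := Fin 2))) k W) c : Matrix.specialUnitaryGroup (Fin 2) ℂ) : Matrix (Fin 2) (Fin 2) ℂ)))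
    (hQ0₁ : ∀ Y, Q₁ 0 Y = Y)
    (hQs₁ : ∀ (k : ℕ) (Y : PBond (F.P K) 0 → Matrix (Fin 2) (Fin 2) ℂ) (c : PBond (F.P K) (k + 1)), Q₁ (k + 1) Y c
      = (fderiv ℂ (eml : (Idx (F.P K) → Matrix (Fin 2) (Fin 2) ℂ) → Matrix (Fin 2) (Fin 2) ℂ)
            (fun i => ((loopHol (Averaging.iter (fun i => blockAvg (P := (F.P K)) (j := i) (expMeanLogSU (n := Fin 2))) k
              (1 : GaugeField (F.P K) 0 (Matrix.specialUnitaryGroup (Fin 2) ℂ))) c i : Matrix.specialUnitaryGroup (Fin 2) ℂ) : Matrix (Fin 2) (Fin 2) ℂ))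
            (fun i => covWalkSum (Averaging.iter (fun i => blockAvg (P := (F.P K)) (j := i) (expMeanLogSU (n := Fin 2))) k
                (1 : GaugeField (F.P K) 0 (Matrix.specialUnitaryGroup (Fin 2) ℂ))) (Q₁ k Y) (walk (emb c.src) (loopWord (F.P K).L c.dir (off i.1) i.2.1 i.2.2))
              * ((loopHol (Averaging.iter (fun i => blockAvg (P := (F.P K)) (j := i) (expMeanLogSU (n := Fin 2))) k
                (1 : GaugeField (F.P K) 0 (Matrix.specialUnitaryGroup (Fin 2) ℂ))) c i : Matrix.specialUnitaryGroup (Fin 2) ℂ) : Matrix (Fin 2) (Fin 2) ℂ))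
            * star ((corr (expMeanLogSU (n := Fin 2)) (Averaging.iter (fun i => blockAvg (P := (F.P K)) (j := i) (expMeanLogSU (n := Fin 2))) k
                (1 : GaugeField (F.P K) 0 (Matrix.specialUnitaryGroup (Fin 2) ℂ))) c : Matrix.specialUnitaryGroup (Fin 2) ℂ) : Matrix (Fin 2) (Fin 2) ℂ)
          + ((corr (expMeanLogSU (n := Fin 2)) (Averaging.iter (fun i => blockAvg (P := (F.P K)) (j := i) (expMeanLogSU (n := Fin 2))) k
                (1 : GaugeField (F.P K) 0 (Matrix.specialUnitaryGroup (Fin 2) ℂ))) c : Matrix.specialUnitaryGroup (Fin 2) ℂ) : Matrix (Fin 2) (Fin 2) ℂ)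
            * covWalkSum (Averaging.iter (fun i => blockAvg (P := (F.P K)) (j := i) (expMeanLogSU (n := Fin 2))) k
                (1 : GaugeField (F.P K) 0 (Matrix.specialUnitaryGroup (Fin 2) ℂ))) (Q₁ k Y) (walk (emb c.src) (List.replicate (F.P K).L (c.dir, true)))
            * star ((corr (expMeanLogSU (n := Fin 2)) (Averaging.iter (fun i => blockAvg (P := (F.P K)) (j := i) (expMeanLogSU (n := Fin 2))) k
                (1 : GaugeField (F.P K) 0 (Matrix.specialUnitaryGroup (Fin 2) ℂ))) c : Matrix.specialUnitaryGroup (Fin 2) ℂ) : Matrix (Fin 2) (Fin 2) ℂ)))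
    (Cq Cq' : ℝ) (c : PBond (F.P K) 0 → ℂ)
    (hflat :
      ∑ c' : PBond (F.P K) (K - n), ‖Q₁ (K - n) (fun b => c b • (1 : Matrix (Fin 2) (Fin 2) ℂ)) c'‖ ^ 2
        ≤ 2 * (∑ c' : PBond (F.P n) 0, ‖(frobEquiv.symm (QTw F n K hnK.le (1 : GaugeField (F.P K) 0 (Matrix.specialUnitaryGroup (Fin 2) ℂ))
              (fun b => c b • (1 : Matrix (Fin 2) (Fin 2) ℂ)) c') : W₂)‖ ^ 2)
          + Cq * (F.L : ℝ) ^ (K - n) * ((∑ x : Site (F.P K) 0, ∑ μ : Fin (F.P K).d, ∑ ν : Fin (F.P K).d,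
                (if μ < ν then ∑ j : Fin 2, ∑ k : Fin 2,
                  ‖(curl (torusT (F.P K) 0) (fun κ z => unitsField (toUField (1 : GaugeField (F.P K) 0 (Matrix.specialUnitaryGroup (Fin 2) ℂ))) ⟨z, κ⟩)
                      (fun κ z => c ⟨z, κ⟩ • (1 : Matrix (Fin 2) (Fin 2) ℂ)) μ ν x) j k‖ ^ 2 else 0))
              + (∑ x : Site (F.P K) 0, ∑ j : Fin 2, ∑ k : Fin 2,
                ‖(divB (torusT (F.P K) 0) (fun κ z => unitsField (toUField (1 : GaugeField (F.P K) 0 (Matrix.specialUnitaryGroup (Fin 2) ℂ))) ⟨z, κ⟩)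
                    (fun κ z => c ⟨z, κ⟩ • (1 : Matrix (Fin 2) (Fin 2) ℂ)) x) j k‖ ^ 2))
          + Cq' * e * ((F.L : ℝ) ^ (K - n))⁻¹ * (∑ b : PBond (F.P K) 0, ‖c b • (1 : Matrix (Fin 2) (Fin 2) ℂ)‖ ^ 2)) :
    ∑ c' : PBond (F.P K) (K - n), ‖Q (K - n) (fun b => c b • (1 : Matrix (Fin 2) (Fin 2) ℂ)) c'‖ ^ 2
      ≤ 2 * (∑ c' : PBond (F.P n) 0, ‖(frobEquiv.symm (QTw F n K hnK.le W (fun b => c b • (1 : Matrix (Fin 2) (Fin 2) ℂ)) c') : W₂)‖ ^ 2)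
        + Cq * (F.L : ℝ) ^ (K - n) * ((∑ x : Site (F.P K) 0, ∑ μ : Fin (F.P K).d, ∑ ν : Fin (F.P K).d,
              (if μ < ν then ∑ j : Fin 2, ∑ k : Fin 2,
                ‖(curl (torusT (F.P K) 0) (fun κ z => unitsField (toUField W) ⟨z, κ⟩) (fun κ z => c ⟨z, κ⟩ • (1 : Matrix (Fin 2) (Fin 2) ℂ)) μ ν x) j k‖ ^ 2 else 0))
            + (∑ x : Site (F.P K) 0, ∑ j : Fin 2, ∑ k : Fin 2,
              ‖(divB (torusT (F.P K) 0) (fun κ z => unitsField (toUField W) ⟨z, κ⟩) (fun κ z => c ⟨z, κ⟩ • (1 : Matrix (Fin 2) (Fin 2) ℂ)) x) j k‖ ^ 2))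
        + Cq' * e * ((F.L : ℝ) ^ (K - n))⁻¹ * (∑ b : PBond (F.P K) 0, ‖c b • (1 : Matrix (Fin 2) (Fin 2) ℂ)‖ ^ 2) := by
  -- (i) the true averages: curved family = flat family on the centre
  have hQ : Q (K - n) (fun b => c b • (1 : Matrix (Fin 2) (Fin 2) ℂ)) = Q₁ (K - n) (fun b => c b • (1 : Matrix (Fin 2) (Fin 2) ℂ)) :=
    (trueLinIter_smul_one_eq_flat_of_regPr F he hε W hreg Q Q₁ hQ0 hQs hQ0₁ hQs₁ le_rfl c).1
  -- (ii) the comb chart on the centre is the flat one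
  have hT : QTw F n K hnK.le W (fun b => c b • (1 : Matrix (Fin 2) (Fin 2) ℂ))
      = QTw F n K hnK.le (1 : GaugeField (F.P K) 0 (Matrix.specialUnitaryGroup (Fin 2) ℂ)) (fun b => c b • (1 : Matrix (Fin 2) (Fin 2) ℂ)) :=
    QTw_smul_one_eq_QTw_one_of_regPr F hnK.le he hε W hreg c
  -- (iii)–(iv) covariant curl and divergence of a central field do not see the background
  have hC : ∀ (μ ν : Fin (F.P K).d) (x : Site (F.P K) 0),
      curl (torusT (F.P K) 0) (fun κ z => unitsField (toUField W) ⟨z, κ⟩) (fun κ z => c ⟨z, κ⟩ • (1 : Matrix (Fin 2) (Fin 2) ℂ)) μ ν x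
        = curl (torusT (F.P K) 0) (fun κ z => unitsField (toUField (1 : GaugeField (F.P K) 0 (Matrix.specialUnitaryGroup (Fin 2) ℂ))) ⟨z, κ⟩)
            (fun κ z => c ⟨z, κ⟩ • (1 : Matrix (Fin 2) (Fin 2) ℂ)) μ ν x := fun μ ν x =>
    curl_smul_one_eq (torusT (F.P K) 0) _ _ (fun κ z => c ⟨z, κ⟩) μ ν x
  have hD : ∀ x : Site (F.P K) 0,
      divB (torusT (F.P K) 0) (fun κ z => unitsField (toUField W) ⟨z, κ⟩) (fun κ z => c ⟨z, κ⟩ • (1 : Matrix (Fin 2) (Fin 2) ℂ)) x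
        = divB (torusT (F.P K) 0) (fun κ z => unitsField (toUField (1 : GaugeField (F.P K) 0 (Matrix.specialUnitaryGroup (Fin 2) ℂ))) ⟨z, κ⟩)
            (fun κ z => c ⟨z, κ⟩ • (1 : Matrix (Fin 2) (Fin 2) ℂ)) x := fun x =>
    divB_smul_one_eq (torusT (F.P K) 0) _ _ (fun κ z => c ⟨z, κ⟩) x
  rw [hQ, hT]
  simp only [hC, hD]
  exact hflat

end Member

end Summit.QuantumFields.YangMills.Theorems.Prop7TrueAvgBudgetCentral

end
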